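import Mathlib

/-!
# C-025 at q = 3: closed forms for the planar sums of the lifted rule R₃⁺ (night-3)

Closed forms (powers of 2 and binomials) for the sums that occur in the planar per-flat inequalities
(T_t^{R₃⁺})(p,3) of the lifted rule R₃⁺ at type t = 2, p = n + 4 (outside points p − 2 = n + 2):
* `phiClosed n` = Φ(p,3) = Σ_{x=1}^{p−4} C(p,x)/C(x+3,3) (`phi_closed`);
* `tieClosed n` = Σ_{x=1}^{p−4} C(p−2,x)/(x+1), the hard-max tie share of a near-pencil at t = 2 (`tie_closed`);
* `t0Closed n` = Σ_{x=1}^{p−4} C(p−2,x)/C(x+3,3), the R₃ share sum of a triple at t = 2 (`t0_closed`);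
* `t1Closed n` = Σ_{x=1}^{p−4} C(p−2,x)/C(x+4,3), the pure R₃ share sum of a 4-set at t = 2 (`t1_closed`).
Every identity is Pascal / `Nat.choose_mul` plus the binomial sum `Nat.sum_range_choose`; no `decide`, no tables.
These turn every planar inequality of the near-pencil family (k-line + point at t = 2: triples with share `1/C(x+3,3)`,
lined 4-sets with share `≥ 3/C(x+4,3)`, the k-line + point subsets with the hard-max tie share `1/(x+1)`) into an
explicit inequality between powers of 2 and polynomials in p (the family theorem is the next module).
-/

namespace PercRepro.NightThree.CF

open Finset

/-- `Σ_{y ∈ Ico a b} C(N, y) = 2^N − Σ_{y < a} C(N,y) − Σ_{y ∈ Ico b (N+1)} C(N,y)` (in `ℚ`). -/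
theorem sum_choose_Ico (N a b : ℕ) (hab : a ≤ b) (hb : b ≤ N + 1) :
    (∑ y ∈ Ico a b, (N.choose y : ℚ)) =
      2 ^ N - (∑ y ∈ range a, (N.choose y : ℚ)) - ∑ y ∈ Ico b (N + 1), (N.choose y : ℚ) := by
  have h1 := sum_range_add_sum_Ico (fun y => (N.choose y : ℚ)) (show a ≤ N + 1 by omega)
  have h2 := sum_Ico_consecutive (fun y => (N.choose y : ℚ)) hab hb
  have h3 : (∑ y ∈ range (N + 1), (N.choose y : ℚ)) = 2 ^ N := by exact_mod_cast Nat.sum_range_choose N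
  linarith

/-- The tail `Σ_{y ∈ Ico (N+1−c) (N+1)} C(N, y) = Σ_{y < c} C(N, y)` by symmetry (`c ≤ N + 1`). -/
theorem sum_choose_tail (N c : ℕ) (hc : c ≤ N + 1) :
    (∑ y ∈ Ico (N + 1 - c) (N + 1), (N.choose y : ℚ)) = ∑ y ∈ range c, (N.choose y : ℚ) := by
  rw [sum_Ico_eq_sum_range, show N + 1 - (N + 1 - c) = c by omega]
  -- reverse the range: y ↦ c - 1 - y
  rw [← sum_range_reflect]
  apply sum_congr rfl
  intro i hi
  rw [mem_range] at hi
  congr 1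
  exact Nat.choose_symm_of_eq_add (by omega)

/-- Reindexing: `Σ_{i < n} C(N, i + a) = Σ_{y ∈ Ico a (a + n)} C(N, y)`. -/
theorem sum_choose_shift (N a n : ℕ) :
    (∑ i ∈ range n, (N.choose (i + a) : ℚ)) = ∑ y ∈ Ico a (a + n), (N.choose y : ℚ) := by
  rw [sum_Ico_eq_sum_range, show a + n - a = n by omega]
  apply sum_congr rfl
  intro i _
  rw [add_comm a i]

/-- `Σ_{y<4} C(N,y)` spelled out. -/
theorem sum_range_four (N : ℕ) :
    (∑ y ∈ range 4, (N.choose y : ℚ)) = 1 + N + (N.choose 2 : ℚ) + (N.choose 3 : ℚ) := by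
  simp [sum_range_succ]

/-- `Σ_{y<5} C(N,y)` spelled out. -/
theorem sum_range_five (N : ℕ) :
    (∑ y ∈ range 5, (N.choose y : ℚ)) = 1 + N + (N.choose 2 : ℚ) + (N.choose 3 : ℚ) + (N.choose 4 : ℚ) := by
  simp [sum_range_succ]

/-- `Σ_{y<2} C(N,y) = 1 + N`. -/
theorem sum_range_two (N : ℕ) : (∑ y ∈ range 2, (N.choose y : ℚ)) = 1 + N := by
  simp [sum_range_succ]

/-- The closed form of `Φ(p,3)`, `p = n + 4`: `(2^{p+3} − 2(1 + (p+3) + C(p+3,2) + C(p+3,3))) / C(p+3,3)`. -/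
def phiClosed (n : ℕ) : ℚ :=
  (2 ^ (n + 7) - 2 * (1 + (n + 7 : ℚ) + ((n + 7).choose 2 : ℚ) + ((n + 7).choose 3 : ℚ))) / ((n + 7).choose 3 : ℚ)

/-- `Φ(p,3) = Σ_{x=1}^{p−4} C(p,x)/C(x+3,3)` equals its closed form (the witness form is `phiW n` of
`RLSPlanarIdentities`; termwise `C(p,x)/C(x+3,3) = C(p+3,x+3)/C(p+3,3)`). -/
theorem phi_closed (n : ℕ) :
    (∑ i ∈ range n, ((n + 4).choose (i + 1) : ℚ) / ((i + 4).choose 3 : ℚ)) = phiClosed n := by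
  have hpos : (((n + 7).choose 3 : ℕ) : ℚ) ≠ 0 := by exact_mod_cast (Nat.choose_pos (by omega)).ne'
  have hterm : ∀ i ∈ range n, ((n + 4).choose (i + 1) : ℚ) / ((i + 4).choose 3 : ℚ) =
      ((n + 7).choose (i + 4) : ℚ) / ((n + 7).choose 3 : ℚ) := by
    intro i _
    have hx : (((i + 4).choose 3 : ℕ) : ℚ) ≠ 0 := by exact_mod_cast (Nat.choose_pos (by omega)).ne'
    rw [div_eq_div_iff hx hpos]
    have h := Nat.choose_mul (n := n + 7) (k := i + 4) (s := 3) (by omega)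
    rw [show n + 7 - 3 = n + 4 by omega, show i + 4 - 3 = i + 1 by omega] at h
    have h' : ((n + 7).choose (i + 4) : ℚ) * ((i + 4).choose 3 : ℚ) = ((n + 7).choose 3 : ℚ) * ((n + 4).choose (i + 1) : ℚ) := by
      exact_mod_cast h
    linear_combination -h'
  rw [sum_congr rfl hterm, ← sum_div, sum_choose_shift (n + 7) 4 n, sum_choose_Ico (n + 7) 4 (4 + n) (by omega) (by omega)]
  have ht := sum_choose_tail (n + 7) 4 (by omega)
  rw [show n + 7 + 1 - 4 = 4 + n by omega] at ht
  rw [ht, sum_range_four]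
  unfold phiClosed
  congr 1
  push_cast
  ring

/-- The hard-max tie sum of a near-pencil at `t = 2`, `p = n + 4`: `Σ_{x=1}^{p−4} C(p−2,x)/(x+1)`. -/
def tieSum (n : ℕ) : ℚ := ∑ i ∈ range n, ((n + 2).choose (i + 1) : ℚ) / ((i : ℚ) + 2)

/-- `tieSum n = (2^{n+3} − 2n − 8)/(n+3)`. -/
theorem tie_closed (n : ℕ) : tieSum n = (2 ^ (n + 3) - 2 * (n : ℚ) - 8) / ((n : ℚ) + 3) := by
  have hn : ((n : ℚ) + 3) ≠ 0 := by positivity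
  have hterm : ∀ i ∈ range n, ((n + 2).choose (i + 1) : ℚ) / ((i : ℚ) + 2) =
      ((n + 3).choose (i + 2) : ℚ) / ((n : ℚ) + 3) := by
    intro i _
    have hi : ((i : ℚ) + 2) ≠ 0 := by positivity
    rw [div_eq_div_iff hi hn]
    have h := Nat.add_one_mul_choose_eq (n + 2) (i + 1)
    rw [show n + 2 + 1 = n + 3 by omega, show i + 1 + 1 = i + 2 by omega] at h
    have h' : ((n : ℚ) + 3) * ((n + 2).choose (i + 1) : ℚ) = ((n + 3).choose (i + 2) : ℚ) * ((i : ℚ) + 2) := by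
      exact_mod_cast h
    linear_combination h'
  unfold tieSum
  rw [sum_congr rfl hterm, ← sum_div, sum_choose_shift (n + 3) 2 n, sum_choose_Ico (n + 3) 2 (2 + n) (by omega) (by omega)]
  have ht := sum_choose_tail (n + 3) 2 (by omega)
  rw [show n + 3 + 1 - 2 = 2 + n by omega] at ht
  rw [ht, sum_range_two]
  congr 1
  push_cast
  ring

/-- The R₃ share sum of a triple at `t = 2`: `Σ_{x=1}^{p−4} C(p−2,x)/C(x+3,3)` (`= T n (n+2) 0` of `RLSPlanarIdentities`). -/
def t0Sum (n : ℕ) : ℚ := ∑ i ∈ range n, ((n + 2).choose (i + 1) : ℚ) / ((i + 4).choose 3 : ℚ)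

/-- `t0Sum n = (2^{n+5} − 2 − 2(n+5) − C(n+5,2) − C(n+5,3)) / C(n+5,3)`. -/
theorem t0_closed (n : ℕ) :
    t0Sum n = (2 ^ (n + 5) - 2 - 2 * ((n : ℚ) + 5) - ((n + 5).choose 2 : ℚ) - ((n + 5).choose 3 : ℚ)) /
      ((n + 5).choose 3 : ℚ) := by
  have hpos : (((n + 5).choose 3 : ℕ) : ℚ) ≠ 0 := by exact_mod_cast (Nat.choose_pos (by omega)).ne'
  have hterm : ∀ i ∈ range n, ((n + 2).choose (i + 1) : ℚ) / ((i + 4).choose 3 : ℚ) =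
      ((n + 5).choose (i + 4) : ℚ) / ((n + 5).choose 3 : ℚ) := by
    intro i _
    have hx : (((i + 4).choose 3 : ℕ) : ℚ) ≠ 0 := by exact_mod_cast (Nat.choose_pos (by omega)).ne'
    rw [div_eq_div_iff hx hpos]
    have h := Nat.choose_mul (n := n + 5) (k := i + 4) (s := 3) (by omega)
    rw [show n + 5 - 3 = n + 2 by omega, show i + 4 - 3 = i + 1 by omega] at h
    have h' : ((n + 5).choose (i + 4) : ℚ) * ((i + 4).choose 3 : ℚ) = ((n + 5).choose 3 : ℚ) * ((n + 2).choose (i + 1) : ℚ) := by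
      exact_mod_cast h
    linear_combination -h'
  unfold t0Sum
  rw [sum_congr rfl hterm, ← sum_div, sum_choose_shift (n + 5) 4 n, sum_choose_Ico (n + 5) 4 (4 + n) (by omega) (by omega)]
  have ht := sum_choose_tail (n + 5) 2 (by omega)
  rw [show n + 5 + 1 - 2 = 4 + n by omega] at ht
  rw [ht, sum_range_four, sum_range_two]
  congr 1
  push_cast
  ring

/-- The pure R₃ share sum of a 4-set at `t = 2`: `Σ_{x=1}^{p−4} C(p−2,x)/C(x+4,3)` (`= T n (n+2) 1`). -/
def t1Sum (n : ℕ) : ℚ := ∑ i ∈ range n, ((n + 2).choose (i + 1) : ℚ) / ((i + 5).choose 3 : ℚ)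

/-- Termwise: `C(n+2,i+1)/C(i+5,3) = C(n+2,i+1)/C(i+4,3) − (3/4)·C(n+6,i+5)/C(n+6,4)`. -/
theorem t1_term (n i : ℕ) :
    ((n + 2).choose (i + 1) : ℚ) / ((i + 5).choose 3 : ℚ) =
      ((n + 2).choose (i + 1) : ℚ) / ((i + 4).choose 3 : ℚ) - 3 / 4 * (((n + 6).choose (i + 5) : ℚ) / ((n + 6).choose 4 : ℚ)) := by
  have hP : (((i + 4).choose 3 : ℕ) : ℚ) ≠ 0 := by exact_mod_cast (Nat.choose_pos (by omega)).ne'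
  have hQ : (((i + 5).choose 3 : ℕ) : ℚ) ≠ 0 := by exact_mod_cast (Nat.choose_pos (by omega)).ne'
  have hV : (((n + 6).choose 4 : ℕ) : ℚ) ≠ 0 := by exact_mod_cast (Nat.choose_pos (by omega)).ne'
  -- (a) C(n+6,i+5)·C(i+5,4) = C(n+6,4)·C(n+2,i+1)
  have ha0 := Nat.choose_mul (n := n + 6) (k := i + 5) (s := 4) (by omega)
  rw [show n + 6 - 4 = n + 2 by omega, show i + 5 - 4 = i + 1 by omega] at ha0
  have ha : ((n + 6).choose (i + 5) : ℚ) * ((i + 5).choose 4 : ℚ) = ((n + 6).choose 4 : ℚ) * ((n + 2).choose (i + 1) : ℚ) := by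
    exact_mod_cast ha0
  -- (b) C(i+5,4)·4 = C(i+5,3)·(i+2)
  have hb0 := Nat.choose_succ_right_eq (i + 5) 3
  rw [show i + 5 - 3 = i + 2 by omega] at hb0
  have hb : ((i + 5).choose 4 : ℚ) * 4 = ((i + 5).choose 3 : ℚ) * ((i : ℚ) + 2) := by exact_mod_cast hb0
  -- (c) C(i+5,3) = C(i+4,2) + C(i+4,3)
  have hc0 := Nat.choose_succ_succ' (i + 4) 2
  have hc : ((i + 5).choose 3 : ℚ) = ((i + 4).choose 2 : ℚ) + ((i + 4).choose 3 : ℚ) := by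
    rw [show i + 5 = i + 4 + 1 by omega]; exact_mod_cast hc0
  -- (d) C(i+4,3)·3 = C(i+4,2)·(i+2)
  have hd0 := Nat.choose_succ_right_eq (i + 4) 2
  rw [show i + 4 - 2 = i + 2 by omega] at hd0
  have hd : ((i + 4).choose 3 : ℚ) * 3 = ((i + 4).choose 2 : ℚ) * ((i : ℚ) + 2) := by exact_mod_cast hd0
  have h4V : (4 : ℚ) * ((n + 6).choose 4 : ℚ) ≠ 0 := mul_ne_zero (by norm_num) hV
  rw [eq_sub_iff_add_eq, div_mul_div_comm, div_add_div _ _ hQ h4V, div_eq_div_iff (mul_ne_zero hQ h4V) hP]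
  linear_combination (-(4 * ((n + 2).choose (i + 1) : ℚ) * ((n + 6).choose 4 : ℚ))) * hc
    + 4 * ((i + 4).choose 2 : ℚ) * ha - ((n + 6).choose (i + 5) : ℚ) * ((i + 4).choose 2 : ℚ) * hb
    + ((n + 6).choose (i + 5) : ℚ) * ((i + 5).choose 3 : ℚ) * hd

/-- `t1Sum n = t0Sum n − 3·(2^{n+6} − 2 − 2(n+6) − C(n+6,2) − C(n+6,3) − C(n+6,4)) / (4·C(n+6,4))`. -/
theorem t1_closed (n : ℕ) :
    t1Sum n = t0Sum n - 3 * (2 ^ (n + 6) - 2 - 2 * ((n : ℚ) + 6) - ((n + 6).choose 2 : ℚ) - ((n + 6).choose 3 : ℚ)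
      - ((n + 6).choose 4 : ℚ)) / (4 * ((n + 6).choose 4 : ℚ)) := by
  have hV : (((n + 6).choose 4 : ℕ) : ℚ) ≠ 0 := by exact_mod_cast (Nat.choose_pos (by omega)).ne'
  unfold t1Sum t0Sum
  rw [sum_congr rfl (fun i _ => t1_term n i), sum_sub_distrib, ← mul_sum, ← sum_div]
  rw [sum_choose_shift (n + 6) 5 n, sum_choose_Ico (n + 6) 5 (5 + n) (by omega) (by omega)]
  have ht := sum_choose_tail (n + 6) 2 (by omega)
  rw [show n + 6 + 1 - 2 = 5 + n by omega] at ht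
  rw [ht, sum_range_five, sum_range_two]
  congr 1
  field_simp
  push_cast
  ring

end PercRepro.NightThree.CF
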